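import Summits.QuantumFields.YangMills.Theses.LangevinControlUV
import Summits.QuantumFields.YangMills.Theorems.LangevinControlUVOSLegsFromFemtoAndGapStubPinAux

/-!
# Crux `LatticeGapInUVUnitsC` (stmt-QuantumFields-16206), line `Sketch` (amplitude-exhaustion-ratchet): stub `stub_seed`

Registered stub S1 (the SEED) of the skeleton `work/LatticeGapInUVUnitsC.lean` of route `LangevinControlUV` of
`YangMills`.  The line proves the crux by exhaustion of the dimensionless top-of-box curvature amplitude

  `u(β, N) := N⁸ · Cov_{β,(ℤ/8N)⁴}(P_0^{01}, P_{N e₂}^{01})`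

along a dyadic ladder starting at the femto edge.  This file is the seed: `u ≥ umin > 0` on the top femto octave
`ℓ₀/16 ≤ N a(β) ≤ ℓ₀/8`, for every `β ≥ β₀` — the one place where the LOWER bound `c Γ ≤ n⁸ Cov` of the femto
two-point package does infrared work.  It is bookkeeping over the landed interval pinning for continuous unit maps
(`OSLegsFromFemtoAndGap.pinning_of_femtoBox`): `Γ ≥ m > 0` on `[ℓ₀/16, ℓ₀/8]`, and the package's axis clause on the
torus `L = 8N` at separation `n = N` gives `u(β, N) ≥ c Γ(N a β) ≥ c m =: umin`.
-/

set_option autoImplicit false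

open MeasureTheory Filter Topology
open Literature.MathematicalPhysics.QuantumFieldTheory Literature.MathematicalPhysics.QuantumLattice

noncomputable section

namespace Summit.QuantumFields.YangMills.Theorems.LatticeGapInUVUnitsC.AmplitudeRatchet

/-- **Stub S1 — SEED** (bookkeeping; the one place the package's LOWER bound does infrared work).  For a CONTINUOUS
unit map `a` carrying the femto two-point package (positivity and vanishing of `a`, shape `0 < Γ ≤ 1` on `(0, ℓ₀]`,
constants `β₀`, `ℓ₀ > 0`, `c > 0`, `C`, and the verbatim femto-box clause on all tori `L a(β) ≤ ℓ₀`, `β ≥ β₀`), the axis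
amplitude `N⁸ Cov_{β,(ℤ/8N)⁴}(P_0^{01}, P_{N e₂}^{01})` on the top femto octave `ℓ₀/16 ≤ N a(β) ≤ ℓ₀/8` is bounded
below by `umin = c · m > 0`, `m = min_{[ℓ₀/16, ℓ₀/8]} Γ` (`pinning_of_femtoBox`), for all `β ≥ β₀`: the octave forces
`N ≥ 1` and `8N · a(β) ≤ ℓ₀`, so the package's axis clause at `L = 8N`, `n = N` gives `c Γ(N a β) ≤` amplitude, and
`Γ(N a β) ≥ m`. -/
theorem stub_seed : ∀ (G : Type) [Group G] [TopologicalSpace G] [IsTopologicalGroup G] [CompactSpace G] [MeasurableSpace G] [BorelSpace G] (r : LatticeRep G) (a Γ : ℝ → ℝ) (β₀ ℓ₀ c C : ℝ), Continuous a → 0 < ℓ₀ → 0 < c → (∀ β, 0 < a β) → Filter.Tendsto a Filter.atTop (nhds 0) → (∀ s : ℝ, 0 < s → s ≤ ℓ₀ → 0 < Γ s ∧ Γ s ≤ 1) → (∀ (L : ℕ) [NeZero L] (β : ℝ), β₀ ≤ β → (L : ℝ) * a β ≤ ℓ₀ → let P : (Fin 4 → ZMod L) → Fin 4 → Fin 4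 → GaugeConfig 4 L G → ℝ := fun x i j U => (r.N : ℝ) - (r.ρ (plaquetteHolonomy U x i j)).trace.re; let E : (GaugeConfig 4 L G → ℝ) → ℝ := fun F => wilsonExpectation (d := 4) (L := L) r.ρ β F; let cov : (GaugeConfig 4 L G → ℝ) → (GaugeConfig 4 L G → ℝ) → ℝ := fun F F' => E (fun U => F U * F' U) - E F * E F'; let dist : (Fin 4 → ZMod L) → (Fin 4 → ZMod L) → ℝ := fun x y => Real.sqrt (∑ k : Fin 4, (((x k - y k).valMinAbs : ℤ) : ℝ) ^ 2); (∀ n : ℕ, 1 ≤ n → 8 * n ≤ L → c * Γ ((n : ℝ) * a β) ≤ (n : ℝ) ^ 8 * cov (P 0 0 1) (P (Pi.single (2 : Fin 4) ((n : ℕ) : ZMod L)) 0 1) ∧ (n : ℝ) ^ 8 * cov (P 0 0 1) (P (Pi.single (2 : Fin 4) ((n : ℕ) : ZMod L)) 0 1) ≤ C * Γ ((n : ℝ) * a β)) ∧ (∀ (x y : Fin 4 → ZMod L) (i j i' j' : Fin 4), x ≠ y → i ≠ j → i' ≠ j' → |cov (P x i j) (P y i' j')| * dist x y ^ 8 ≤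 C * Γ (dist x y * a β))) → ∃ umin : ℝ, 0 < umin ∧ ∀ β : ℝ, β₀ ≤ β → ∀ (N : ℕ) [NeZero (8 * N)], ℓ₀ ≤ 16 * ((N : ℝ) * a β) → 8 * ((N : ℝ) * a β) ≤ ℓ₀ → umin ≤ ((N : ℕ) : ℝ) ^ 8 * (wilsonExpectation r.ρ β (fun U : GaugeConfig 4 (8 * N) G => ((r.N : ℝ) - (r.ρ (plaquetteHolonomy U 0 0 1)).trace.re) * ((r.N : ℝ) - (r.ρ (plaquetteHolonomy U (Pi.single (2 : Fin 4) ((N : ℕ) : ZMod (8 * N))) 0 1)).trace.re)) - wilsonExpectation r.ρ β (fun U : GaugeConfig 4 (8 * N) G => (r.N : ℝ) - (r.ρ (plaquetteHolonomy U 0 0 1)).trace.re) * wilsonExpectation r.ρ β (fun U : GaugeConfig 4 (8 * N) G => (r.N : ℝ) - (r.ρ (plaquetteHolonomy U (Pi.single (2 : Fin 4) ((N : ℕ) : ZMod (8 * N))) 0 1)).trace.re)) := by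
  intro G _ _ _ _ _ _ r a Γ β₀ ℓ₀ c C ha hℓ₀ hc hpos hlim hΓ hbox
  -- interval pinning of the shape function on the top femto octave `[ℓ₀/16, ℓ₀/8]`
  obtain ⟨m, hm, hmΓ⟩ :=
    Summit.QuantumFields.YangMills.Theorems.OSLegsFromFemtoAndGap.pinning_of_femtoBox r ha hc hpos hlim hΓ hbox
      (ℓ₀ / 16) (ℓ₀ / 8) (by positivity) (by linarith) (by linarith)
  refine ⟨c * m, mul_pos hc hm, fun β hβ N _ h16 h8 => ?_⟩
  -- the octave forces `N ≥ 1`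
  have hN : 1 ≤ N := by
    rcases Nat.eq_zero_or_pos N with h | h
    · exfalso
      rw [h, Nat.cast_zero, zero_mul, mul_zero] at h16
      linarith
    · exact h
  -- the torus `L = 8N` is a femto torus
  have hL : ((8 * N : ℕ) : ℝ) * a β ≤ ℓ₀ := by push_cast; linarith
  -- the package's axis clause at `L = 8N`, separation `n = N`: lower bound `c Γ(N a β) ≤ amplitude`
  obtain ⟨hax, -⟩ := hbox (8 * N) β hβ hL
  have hlow := (hax N hN le_rfl).1
  -- `Γ(N a β) ≥ m` since `N a β ∈ [ℓ₀/16, ℓ₀/8]`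
  have hΓm : m ≤ Γ ((N : ℝ) * a β) := hmΓ _ (by linarith) (by linarith)
  exact le_trans (mul_le_mul_of_nonneg_left hΓm hc.le) hlow

end Summit.QuantumFields.YangMills.Theorems.LatticeGapInUVUnitsC.AmplitudeRatchet

end
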